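import Literature.MathematicalPhysics.StatisticalMechanics.BarlowCoordination
import Mathlib.Analysis.Normed.Affine.MazurUlam
import Mathlib.Analysis.InnerProductSpace.PiL2

/-!
# Isometries of infinite order of an ideal Barlow stacking have a translation power

Helper file B of stub `stub_powerTranslation` (line `develop-the-model-growth-descent`, crux
`ShellsToBarlowChart`, stmt-AtomisticToContinuum-9227), on the MODEL
`B = barlowStacking 1 √(2/3) s` only (Bieberbach for the stacking): an isometry `g` of `ℝ³`
mapping `B` into itself, none of whose positive powers is the identity, has a positive power
which is the translation by a non-zero vector (`isometry_pow_eq_translation`).  The linear part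
of `g` maps the finite set `D` of bond vectors `q' − q` (`q, q' ∈ B` touching) into itself; by
pigeonhole two powers agree on `D`, so some positive power of the linear part fixes `D`, which
spans `ℝ³`; that power of `g` is then a translation, non-zero by hypothesis.
-/

noncomputable section

namespace Summit.AtomisticToContinuum.Crystallization.Theorems.PalmUnimodularRigidityShellsToBarlowChart

open Literature.MathematicalPhysics.StatisticalMechanics

/-- Euclidean `3`-space. -/
local notation "E3" => EuclideanSpace ℝ (Fin 3)

/-! ## Linear parts of isometries -/

/-- Mazur–Ulam at the origin: `g z = L z + g 0` with `L` the linear part of `g`. [folklore] -/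
theorem ptB_apply_eq (g : E3 ≃ᵢ E3) (z : E3) :
    g z = g.toRealAffineIsometryEquiv.linearIsometryEquiv z + g 0 := by
  have h := g.toRealAffineIsometryEquiv.map_vsub z 0
  simp only [IsometryEquiv.coeFn_toRealAffineIsometryEquiv, vsub_eq_sub, sub_zero] at h
  rw [h, sub_add_cancel]

/-- The linear part on differences. [folklore] -/
theorem ptB_lin_sub (g : E3 ≃ᵢ E3) (a b : E3) :
    g.toRealAffineIsometryEquiv.linearIsometryEquiv (a - b) = g a - g b := by
  rw [map_sub, ptB_apply_eq g a, ptB_apply_eq g b]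
  abel

/-- The linear part of a product is the product of the linear parts. [folklore] -/
theorem ptB_lin_mul (g h : E3 ≃ᵢ E3) (z : E3) :
    (g * h).toRealAffineIsometryEquiv.linearIsometryEquiv z =
      g.toRealAffineIsometryEquiv.linearIsometryEquiv
        (h.toRealAffineIsometryEquiv.linearIsometryEquiv z) := by
  have e1 : (g * h).toRealAffineIsometryEquiv.linearIsometryEquiv z = (g * h) z - (g * h) 0 := by
    rw [← sub_zero z, ptB_lin_sub, sub_zero]
  have e2 : h.toRealAffineIsometryEquiv.linearIsometryEquiv z = h z - h 0 := by
    rw [← sub_zero z, ptB_lin_sub, sub_zero]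
  rw [e1, e2, ptB_lin_sub, IsometryEquiv.mul_apply, IsometryEquiv.mul_apply]

/-! ## The bond vectors of the model: finite and spanning -/

/-- **The bond vectors of the ideal stacking form a finite set** (their integer coordinates
`(i' − i, j' − j, L k' − L k, k' − k)` in the frame `u, v, w, h e₃` lie in a box). [folklore] -/
theorem ptB_bondVectors_finite {s : ℤ → ℤ} (hs : IsHaggSeq s) :
    {d : E3 | ∃ q ∈ barlowStacking 1 (Real.sqrt (2 / 3)) s, ∃ q' ∈ barlowStacking 1 (Real.sqrt (2 / 3)) s,
      dist q q' = 1 ∧ d = q' - q}.Finite := by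
  have hsq : Real.sqrt (2 / 3) ^ 2 = 2 / 3 * (1 : ℝ) ^ 2 := by rw [Real.sq_sqrt (by norm_num)]; norm_num
  set F : ℤ × ℤ × ℤ × ℤ → E3 := fun t => (t.1 : ℝ) • triangularVec₁ 1 + (t.2.1 : ℝ) • triangularVec₂ 1 +
    (t.2.2.1 : ℝ) • barlowOffset 1 + (t.2.2.2 : ℝ) • layerNormal (Real.sqrt (2 / 3)) with hF
  set box : Finset (ℤ × ℤ × ℤ × ℤ) :=
    Finset.Icc (-2) 2 ×ˢ (Finset.Icc (-1) 1 ×ˢ (Finset.Icc (-1) 1 ×ˢ Finset.Icc (-1) 1)) with hbox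
  refine ((box.finite_toSet).image F).subset ?_
  rintro d ⟨q, ⟨k, i, j, rfl⟩, q', ⟨k', i', j', rfl⟩, hd, rfl⟩
  have hform := (dist_barlowPos_eq_iff_form one_pos hsq s k i j k' i' j').1 hd
  set Λ : ℤ := haggLabel s k - haggLabel s k' with hΛ
  have hK : (k - k') ^ 2 < 2 ^ 2 := by
    nlinarith [sq_nonneg (2 * (i - i') + (j - j') + Λ), sq_nonneg (3 * (j - j') + Λ)]
  obtain ⟨hK1, hK2⟩ := abs_lt_of_sq_lt_sq' hK (by norm_num)
  have hΛb : -1 ≤ Λ ∧ Λ ≤ 1 := by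
    rcases (show k' = k + 1 ∨ k = k' ∨ k' = k - 1 by omega) with h | h | h
    · rw [hΛ, h, haggLabel_sub_haggLabel_succ]; rcases hs k with h1 | h1 <;> omega
    · rw [hΛ, h, sub_self]; omega
    · rw [hΛ, h, haggLabel_sub_haggLabel_pred]; rcases hs (k - 1) with h1 | h1 <;> omega
  have hQ : (3 * (j - j') + Λ) ^ 2 < 4 ^ 2 := by
    nlinarith [sq_nonneg (2 * (i - i') + (j - j') + Λ), sq_nonneg (k - k')]
  have hP : (2 * (i - i') + (j - j') + Λ) ^ 2 < 3 ^ 2 := by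
    nlinarith [sq_nonneg (3 * (j - j') + Λ), sq_nonneg (k - k')]
  obtain ⟨hQ1, hQ2⟩ := abs_lt_of_sq_lt_sq' hQ (by norm_num)
  obtain ⟨hP1, hP2⟩ := abs_lt_of_sq_lt_sq' hP (by norm_num)
  refine ⟨(i' - i, j' - j, haggLabel s k' - haggLabel s k, k' - k), ?_, ?_⟩
  · simp only [hbox, Finset.mem_coe, Finset.mem_product, Finset.mem_Icc]
    omega
  · simp only [hF, barlowPos]
    push_cast
    module

/-- **The bond vectors of the ideal stacking span `ℝ³`** (they contain `u`, `v` and the up-bond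
`L(1) w + h e₃`, the period vectors of `BarlowStacking.linearIndependent_barlowPeriodVec`).
[folklore] -/
theorem ptB_span_bondVectors {s : ℤ → ℤ} (hs : IsHaggSeq s) :
    Submodule.span ℝ {d : E3 | ∃ q ∈ barlowStacking 1 (Real.sqrt (2 / 3)) s,
      ∃ q' ∈ barlowStacking 1 (Real.sqrt (2 / 3)) s, dist q q' = 1 ∧ d = q' - q} = ⊤ := by
  have hsq : Real.sqrt (2 / 3) ^ 2 = 2 / 3 * (1 : ℝ) ^ 2 := by rw [Real.sq_sqrt (by norm_num)]; norm_num
  have hh0 : Real.sqrt (2 / 3) ≠ 0 := by positivity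
  have hli := linearIndependent_barlowPeriodVec (a := 1) (h := Real.sqrt (2 / 3)) (p := 1) s
    one_ne_zero hh0 one_ne_zero
  have hspan := hli.span_eq_top_of_card_eq_finrank (by simp)
  rw [eq_top_iff, ← hspan]
  refine Submodule.span_mono ?_
  have hform := fun k i j k' i' j' =>
    (dist_barlowPos_eq_iff_form one_pos hsq s k i j k' i' j').2
  rintro _ ⟨l, rfl⟩
  fin_cases l
  · refine ⟨barlowPos 1 (Real.sqrt (2 / 3)) s 0 0 0, barlowPos_mem _ _ _,
      barlowPos 1 (Real.sqrt (2 / 3)) s 0 1 0, barlowPos_mem _ _ _, hform 0 0 0 0 1 0 (by simp), ?_⟩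
    simp [barlowPeriodVec, barlowPos]
  · refine ⟨barlowPos 1 (Real.sqrt (2 / 3)) s 0 0 0, barlowPos_mem _ _ _,
      barlowPos 1 (Real.sqrt (2 / 3)) s 0 0 1, barlowPos_mem _ _ _, hform 0 0 0 0 0 1 (by simp), ?_⟩
    simp [barlowPeriodVec, barlowPos]
  · refine ⟨barlowPos 1 (Real.sqrt (2 / 3)) s 0 0 0, barlowPos_mem _ _ _,
      barlowPos 1 (Real.sqrt (2 / 3)) s 1 0 0, barlowPos_mem _ _ _, ?_, ?_⟩
    · have := dist_barlowPos_succ_eq 1 (Real.sqrt (2 / 3)) hs 0 0 0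
      rw [zero_add, Real.sq_sqrt (by norm_num)] at this
      rw [dist_comm, this]
      norm_num
    · have hL : (haggLabel s 1 : ℝ) = haggWindow s 0 1 := by
        have := haggLabel_natCast s 1
        rw [Nat.cast_one] at this
        rw [this]
      simp [barlowPeriodVec, barlowPos, hL]

/-! ## Bieberbach for the stacking -/

/-- **An isometry of `ℝ³` mapping the ideal stacking into itself, none of whose positive powers is
the identity, has a positive power which is a non-zero translation.** [folklore] -/
theorem isometry_pow_eq_translation : ∀ s : ℤ → ℤ, IsHaggSeq s → ∀ g : EuclideanSpace ℝ (Fin 3) ≃ᵢ EuclideanSpace ℝ (Fin 3), (∀ p ∈ barlowStacking 1 (Real.sqrt (2 / 3)) s, g p ∈ barlowStacking 1 (Real.sqrt (2 / 3)) s) → (∀ n : ℕ, 1 ≤ n → g ^ n ≠ 1) → ∃ m : ℕ, 1 ≤ m ∧ ∃ v : EuclideanSpace ℝ (Fin 3), v ≠ 0 ∧ ∀ x : EuclideanSpace ℝ (Fin 3), (g ^ m) x = x + v := by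
  intro s hs g hg hng
  set D : Set E3 := {d : E3 | ∃ q ∈ barlowStacking 1 (Real.sqrt (2 / 3)) s,
    ∃ q' ∈ barlowStacking 1 (Real.sqrt (2 / 3)) s, dist q q' = 1 ∧ d = q' - q} with hD
  have hfin : D.Finite := ptB_bondVectors_finite hs
  have hspan : Submodule.span ℝ D = ⊤ := ptB_span_bondVectors hs
  -- powers of `g` map the model into itself
  have hgm : ∀ m : ℕ, ∀ p ∈ barlowStacking 1 (Real.sqrt (2 / 3)) s,
      (g ^ m) p ∈ barlowStacking 1 (Real.sqrt (2 / 3)) s := by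
    intro m
    induction m with
    | zero => intro p hp; simpa using hp
    | succ m ih => intro p hp; rw [pow_succ', IsometryEquiv.mul_apply]; exact hg _ (ih p hp)
  -- their linear parts map the bond vectors into themselves
  have hLD : ∀ m : ℕ, ∀ d ∈ D, (g ^ m).toRealAffineIsometryEquiv.linearIsometryEquiv d ∈ D := by
    rintro m d ⟨q, hq, q', hq', hqq', rfl⟩
    exact ⟨(g ^ m) q, hgm m q hq, (g ^ m) q', hgm m q' hq',
      by rw [IsometryEquiv.dist_eq]; exact hqq', ptB_lin_sub (g ^ m) q' q⟩
  -- pigeonhole on the restrictions to the finite set of bond vectors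
  haveI : Finite D := hfin.to_subtype
  set Φ : ℕ → D → D := fun m d =>
    ⟨(g ^ m).toRealAffineIsometryEquiv.linearIsometryEquiv d, hLD m d d.2⟩ with hΦ
  obtain ⟨m₁, m₂, hne, heq⟩ := Finite.exists_ne_map_eq_of_infinite Φ
  wlog hlt : m₁ < m₂ generalizing m₁ m₂
  · exact this m₂ m₁ hne.symm heq.symm (by omega)
  obtain ⟨m, rfl⟩ := Nat.exists_eq_add_of_le hlt.le
  have hm : 1 ≤ m := by omega
  -- the linear part of `g ^ m` fixes every bond vector, hence is the identity
  have hfix : ∀ d ∈ D, (g ^ m).toRealAffineIsometryEquiv.linearIsometryEquiv d = d := by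
    intro d hd
    have h1 := congrArg (fun φ : D → D => (φ ⟨d, hd⟩ : E3)) heq
    simp only [hΦ] at h1
    rw [pow_add, ptB_lin_mul] at h1
    exact ((g ^ m₁).toRealAffineIsometryEquiv.linearIsometryEquiv.injective h1).symm
  have hid : ∀ x, (g ^ m).toRealAffineIsometryEquiv.linearIsometryEquiv x = x := by
    have : (g ^ m).toRealAffineIsometryEquiv.linearIsometryEquiv.toLinearEquiv.toLinearMap =
        LinearMap.id :=
      LinearMap.ext_on hspan fun d hd => by simpa using hfix d hd
    intro x
    exact LinearMap.congr_fun this x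
  refine ⟨m, hm, (g ^ m) 0, ?_, fun x => ?_⟩
  · intro h0
    apply hng m hm
    refine IsometryEquiv.ext fun x => ?_
    rw [ptB_apply_eq (g ^ m) x, hid, h0, add_zero, IsometryEquiv.coe_one, id]
  · rw [ptB_apply_eq (g ^ m) x, hid]

end Summit.AtomisticToContinuum.Crystallization.Theorems.PalmUnimodularRigidityShellsToBarlowChart

end
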